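import Summits.Ventures.KdS.ClosedHalfPlane
import Summits.Ventures.KdS.Rebind310
import Literature.Geometry.Lorentzian.KerrDeSitterPartialModeStabilityNonzeroFreq
import Literature.Geometry.Lorentzian.KerrDeSitterZeroFrequencyScalarModes
import HarnessLib

/-!
# Venture KdS — the closed-half-plane box theorems bound to the CORRECTED cited fact
# `CasalsTeixeiraDaCosta2022_theorem310` (`ω ≠ 0`; cell ruling A60, delta D-ω0)

HONEST FRAMING (venture `Summits/Ventures/KdS`, cell `pub-kds`, seat P1): theorems only. The landed
`ClosedHalfPlane.lean` binds (H1) as `CasalsTeixeiraDaCosta2022_partialModeStability`, whose typed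
real-axis bullet omits Casals–Teixeira da Costa's standing hypothesis `ω ≠ 0` (Def. 3.4) and is
refutable at `(s, ω, m) = (0, 0, 0)` (cell finding D-ω0, `lit/H1H3-AS-PRINTED.md`); theorems binding it
are kernel-sound but vacuous as typed. This file gives the `_310` TWINS binding the corrected fact
`CasalsTeixeiraDaCosta2022_theorem310` (`KerrDeSitterPartialModeStabilityNonzeroFreq.lean`): on the real
axis off the closed window `|Re ω| > R_m ≥ |m|Ω_SR ≥ 0` already forces `ω ≠ 0`, so the corrected
bullet applies verbatim (`statementAReal_of_310`); the scalar `m = 0` point `ω = 0` — the refuted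
instance — is now taken from the hypothesis-FREE zero-frequency theorem `not_hasMode_zeroFreq`
(`KerrDeSitterZeroFrequencyScalarModes.lean`), every real `ω ≠ 0` with `m = 0` from the corrected bullet
(`statementARealZero_of_310`). The open-half-plane input enters only through the abstract hypotheses
`StatementA B T` / `StatementAScalar B T` (`msTruncClosed_ofA_310`, `msTruncClosedScalar_ofA_310`),
supplied in the assembled twins `msTruncClosed_of_facts'_310`, `b0TheoremClosed_of_certificates_310`,
`noModeClosed_atlas_310` (same binders and order as the originals) by `statementA_of_310` /
`statementAScalar_of_310` of `Rebind310.lean`; nothing of the real-axis disjunct enters the `Im ω > 0`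
chain. Same records, same window constants, same
(H3); no claim beyond the landed statement shapes `MSTruncClosed` / `MSTruncClosedScalar` /
`B0TheoremClosed`.

References: M. Casals, R. Teixeira da Costa, Commun. Math. Phys. 394 (2022) 797–832
[CasalsTeixeiradacosta2022], Def. 3.4 ("`ω ∈ ℂ∖{0}`"), Thm 3.10 (both bullets); cell HOME
`run/shared/lean/pub/pub-kds/` (PLAN A60, lit/H1H3-AS-PRINTED.md D-ω0).
-/

noncomputable section

open Set Complex

namespace Summit.Ventures.KdS

open Literature.Geometry.Lorentzian Literature.Geometry.Lorentzian.KerrDeSitter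

/-! ### The real-axis bullet of the corrected fact, for genuine modes -/

/-- **The real-axis bullet of `CasalsTeixeiraDaCosta2022_theorem310` for a genuine mode.** In the
generic-boundary regime (`s ≤ 0`, and `Re ω ≠ mϖ₂` unless `0 ≤ s`), a subextremal Kerr–de Sitter
parameter point with `a > 0` carries no spin-`s` mode at a REAL frequency `ω ≠ 0` with `m = 0` or
`ω/m ∉ (Ω_low, Ω_SR)` (`λ̄ ∈ ℝ` by `lambdaBar_im_eq_zero_of_real`). Twin of `not_hasMode_real_of_fact`. -/
theorem not_hasMode_real_of_fact_310 (h1 : CasalsTeixeiraDaCosta2022_theorem310)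
    {M a Λ s : ℝ} {ω : ℂ} {m : ℝ} (hsub : IsSubextremal M a Λ) (ha : 0 < a) (haL : |a| < 3 / Λ)
    (haL2 : a ^ 2 < 3 / Λ) (hs : ∃ k : ℤ, 2 * s = k) (hs0 : s ≤ 0) (hk : ∃ k : ℤ, m - s = k)
    (hω0 : ω ≠ 0) (hω : ω.im = 0)
    (hthird : m = 0 ∨ ¬(superradiantLower M a Λ < ω.re / m ∧ ω.re / m < superradiantUpper M a Λ))
    (hray : ω.re ≠ m * horizonAngVel a (rCosmo M a Λ) ∨ 0 ≤ s) :
    ¬HasMode M a Λ s ω m := by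
  rintro ⟨lam, R, hang, hrad, hin, hout, hnt⟩
  exact h1.realAxis_absurd hsub ha.le haL haL2 hs hk hω0 hω
    (lambdaBar_im_eq_zero_of_real hsub.2.1.le hω hang) (Or.inr hthird) (Or.inr hs0) hray hrad hin hout
    hnt

/-- **COVERAGE on the real axis from the corrected (H1) and (H4)**, any box, table and spin `s ≤ 0`
with `2s ∈ ℤ`: off the closed window `|Re ω| > R_m ≥ |m|·Ω_SR ≥ 0`, so `ω ≠ 0`, `ω/m ∉ (Ω_low, Ω_SR)`
(or `m = 0`) and `Re ω ≠ mϖ₂`; the corrected real-axis bullet excludes a mode. Twin of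
`statementAReal_of` with `(h1 : CasalsTeixeiraDaCosta2022_theorem310)`. -/
theorem statementAReal_of_310 {B : Set (ℝ × ℝ × ℝ)} {T : WindowTable} {s : ℝ}
    (h1 : CasalsTeixeiraDaCosta2022_theorem310) (h4 : WindowConstants B T)
    (hs : ∃ k : ℤ, 2 * s = k) (hs0 : s ≤ 0) : StatementAReal B T s := by
  intro p hp ω m hq hk
  obtain ⟨hIm, hm2, hR⟩ := hq
  obtain ⟨hsub, hapos, haL, haL2, -, -, hconst⟩ := h4 p hp
  obtain ⟨hΩ, -, hϖ⟩ := hconst m hm2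
  have hlow := superradiantLower_pos hsub hapos
  have hup := superradiantUpper_pos hsub hapos
  have hR0 : 0 ≤ T.R m := (mul_nonneg (abs_nonneg m) hup.le).trans hΩ
  have hω0 : ω ≠ 0 := by
    intro h
    rw [h, Complex.zero_re, abs_zero] at hR
    exact (not_lt.mpr hR0) hR
  refine not_hasMode_real_of_fact_310 h1 hsub hapos haL haL2 hs hs0 hk hω0 hIm ?_ (Or.inl ?_)
  · by_cases hm0 : m = 0
    · exact Or.inl hm0
    · refine Or.inr ?_
      rintro ⟨hlo, hhi⟩
      have hmpos : 0 < |m| := abs_pos.mpr hm0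
      have hratio : 0 < ω.re / m := hlow.trans hlo
      have habs : |ω.re| / |m| < superradiantUpper p.1 p.2.1 p.2.2 := by
        rw [← abs_div, abs_of_pos hratio]; exact hhi
      have hlt : |ω.re| < |m| * superradiantUpper p.1 p.2.1 p.2.2 :=
        lt_of_lt_of_eq ((div_lt_iff₀ hmpos).mp habs) (mul_comm _ _)
      linarith
  · intro h
    rw [h] at hR
    exact (not_lt.mpr hϖ) hR

/-- The scalar column at `m = 0` on the WHOLE real axis, `ω = 0` included — twin of
`statementARealZero_of`: real `ω ≠ 0` by the corrected real-axis bullet with `m = 0`, and `ω = 0` by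
the hypothesis-free zero-frequency theorem `not_hasMode_zeroFreq` (no `s = 0`, `μ = 1` mode at `ω = 0`
for any `m`; this is exactly the point where the old fact was refutable). -/
theorem statementARealZero_of_310 {B : Set (ℝ × ℝ × ℝ)} {T : WindowTable}
    (h1 : CasalsTeixeiraDaCosta2022_theorem310) (h4 : WindowConstants B T) :
    ∀ p ∈ B, NoModeIn p.1 p.2.1 p.2.2 0 {q | q.1.im = 0 ∧ q.2 = 0} := by
  intro p hp ω m hq hk
  obtain ⟨hIm, hm0⟩ := hq
  obtain ⟨hsub, hapos, haL, haL2, -⟩ := h4 p hp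
  by_cases hω0 : ω = 0
  · subst hω0
    exact not_hasMode_zeroFreq hsub m
  · exact not_hasMode_real_of_fact_310 h1 hsub hapos haL haL2 ⟨0, by norm_num⟩ le_rfl hk hω0 hIm
      (Or.inl hm0) (Or.inr le_rfl)

/-! ### MS_trunc on the closed half-plane from Statement A and the corrected fact -/

/-- **`s = -2`, closed half-plane, corrected (H1):** from Statement A off the window (`Im ω > 0`; to be
supplied by the `_310` twin of `statementA_of`), the corrected fact on the real axis, the window
constants and the records' Statement B̄ (`η ≥ 0`). -/
theorem msTruncClosed_ofA_310 {B : Set (ℝ × ℝ × ℝ)} {T : WindowTable} {η : ℝ}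
    {Λs : ℝ → ℝ → ℂ → ℝ → Set ℂ} (h1 : CasalsTeixeiraDaCosta2022_theorem310)
    (hA : StatementA B T) (h4 : WindowConstants B T) (hη : 0 ≤ η) (hB : StatementBbar B T η Λs) :
    MSTruncClosed B T Λs := by
  intro p hp
  obtain ⟨-, -, -, -, ⟨-, -, hk2, -⟩, hkap, -⟩ := h4 p hp
  exact msTruncClosed_of (hk2.le.trans hkap) hA (statementAReal_of_310 h1 h4 ⟨-4, by norm_num⟩ (by norm_num))
    hη hB p hp

/-- **Scalar column (`s = 0`, `μ = 1`), closed half-plane, corrected (H1):** from the scalar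
Statement A off the window (`Im ω > 0`), the corrected fact on the real axis (`m ≠ 0` off-window,
every real `ω ≠ 0` for `m = 0`), `not_hasMode_zeroFreq` at `ω = 0`, (H4), (H4s) and the scalar
records' Statement B̄. -/
theorem msTruncClosedScalar_ofA_310 {B : Set (ℝ × ℝ × ℝ)} {T : WindowTable} {η : ℝ}
    {Λs : ℝ → ℝ → ℂ → ℝ → Set ℂ} (h1 : CasalsTeixeiraDaCosta2022_theorem310)
    (hA : StatementAScalar B T) (h4 : WindowConstants B T) (h4s : WindowConstantsScalar B T)
    (hη : 0 ≤ η) (hB : StatementBbarScalar B T η Λs) : MSTruncClosedScalar B T Λs := by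
  have hAr := statementAReal_of_310 (s := 0) h1 h4 ⟨0, by norm_num⟩ le_rfl
  have hA0 := statementARealZero_of_310 h1 h4
  intro p hp ω m hq hk lam hlam R hR
  obtain ⟨him, hm⟩ := hq
  by_cases hw : ω ∈ windowClosedScalar T m
  · exact hB p hp ω m ⟨hm, windowClosedScalar_subset_windowBarScalar T hη m hw⟩ hk lam (hlam hw) R hR
  · rcases him.lt_or_eq with hpos | hzero
    · have hw' : ω ∉ windowScalar T m := fun h => hw (windowScalar_subset_windowClosedScalar T m h)
      exact hA p hp ω m ⟨hpos, hm, hw'⟩ hk ⟨lam, R, hR⟩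
    · by_cases hm0 : m = 0
      · exact hA0 p hp ω m ⟨hzero.symm, hm0⟩ hk ⟨lam, R, hR⟩
      · obtain ⟨hsub, hapos, -⟩ := h4 p hp
        have hh0 : 0 ≤ T.h0 m :=
          (mul_pos (abs_pos.mpr hm0) (superradiantUpper_pos hsub hapos)).le.trans (h4s p hp m hm hm0)
        have hre : T.R m < |ω.re| := by
          by_contra hle
          exact hw ⟨hm0, not_lt.mp hle, him, by rw [← hzero]; exact hh0⟩
        exact hAr p hp ω m ⟨hzero.symm, hm, hre⟩ hk ⟨lam, R, hR⟩

/-- **B0, closed half-plane, corrected (H1):** `B0TheoremClosed` from the corrected fact, the two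
Statement A's of B0 (to be supplied by the `_310` substrate twins), rung R2 and the signed records R3. -/
theorem b0TheoremClosed_ofA_310 (h1 : CasalsTeixeiraDaCosta2022_theorem310)
    (hA : StatementA B0 tableB0) (hAs : StatementAScalar B0 tableB0)
    (hR3 : R3_B0Certificates) : B0TheoremClosed :=
  ⟨msTruncClosed_ofA_310 h1 hA r2_windowConstantsB0.1 (by norm_num) hR3.1,
    msTruncClosedScalar_ofA_310 h1 hAs r2_windowConstantsB0.1 r2_windowConstantsB0.2 (by norm_num)
      hR3.2⟩

section Wave

variable {ts : List CertTile}

/-- **MS_trunc on the closed half-plane (`s = -2`) on every tile, corrected (H1)**, given each tile's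
Statement A (from the `_310` substrate twin), window constants and DATA binder. -/
theorem msTruncClosed_atlas_ofA_310 (h1 : CasalsTeixeiraDaCosta2022_theorem310)
    (hA : ∀ t ∈ ts, StatementA t.tile.box t.T) (hWC : ∀ t ∈ ts, WindowConstants t.tile.box t.T)
    (hη : ∀ t ∈ ts, 0 ≤ t.eta) (hdata : ∀ t ∈ ts, t.Data) :
    ∀ t ∈ ts, MSTruncClosed t.tile.box t.T t.lam :=
  fun t ht => msTruncClosed_ofA_310 h1 (hA t ht) (hWC t ht) (hη t ht) (t.statementBbar (hdata t ht))

/-- **The displayed wave theorem on the closed half-plane, pointwise form (`s = -2`), corrected (H1).** -/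
theorem noModeClosed_atlas_ofA_310 (h1 : CasalsTeixeiraDaCosta2022_theorem310)
    (hA : ∀ t ∈ ts, StatementA t.tile.box t.T) (hWC : ∀ t ∈ ts, WindowConstants t.tile.box t.T)
    (hη : ∀ t ∈ ts, 0 ≤ t.eta) (hdata : ∀ t ∈ ts, t.Data) :
    ∀ p ∈ atlas ts, ∃ t ∈ ts, p ∈ t.tile.box ∧
      NoModeWith p.1 p.2.1 p.2.2 (-2) {q | 0 ≤ q.1.im ∧ |q.2| ≤ 2}
        (fun ω m => {lam | ω ∈ windowClosed t.T m → lam ∈ t.lam p.2.1 p.2.2 ω m}) := by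
  rintro p ⟨t, ht, hp⟩
  exact ⟨t, ht, hp, msTruncClosed_atlas_ofA_310 h1 hA hWC hη hdata t ht p hp⟩

end Wave

/-! ### The assembled `_310` twins (same binders and order as the originals of `ClosedHalfPlane.lean`) -/

/-- Twin of `msTruncClosed_of_facts'` binding the corrected fact: `MSTruncClosed` from (H1)
`CasalsTeixeiraDaCosta2022_theorem310`, (H3), (H4) and the records' Statement B̄ (`η ≥ 0`). -/
theorem msTruncClosed_of_facts'_310 {B : Set (ℝ × ℝ × ℝ)} {T : WindowTable} {η : ℝ}
    {Λs : ℝ → ℝ → ℂ → ℝ → Set ℂ} (h1 : CasalsTeixeiraDaCosta2022_theorem310)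
    (h3 : CasalsTeixeiraDaCosta2022_partialModeStabilityProp38) (h4 : WindowConstants B T)
    (hη : 0 ≤ η) (hB : StatementBbar B T η Λs) : MSTruncClosed B T Λs :=
  msTruncClosed_ofA_310 h1 (statementA_of_310 h1 CasalsTeixeiraDaCosta2022_angularSign_holds h3 h4)
    h4 hη hB

/-- Twin of `msTruncClosedScalar_of_facts'` binding the corrected fact. -/
theorem msTruncClosedScalar_of_facts'_310 {B : Set (ℝ × ℝ × ℝ)} {T : WindowTable} {η : ℝ}
    {Λs : ℝ → ℝ → ℂ → ℝ → Set ℂ} (h1 : CasalsTeixeiraDaCosta2022_theorem310)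
    (h4 : WindowConstants B T) (h4s : WindowConstantsScalar B T) (hη : 0 ≤ η)
    (hB : StatementBbarScalar B T η Λs) : MSTruncClosedScalar B T Λs :=
  msTruncClosedScalar_ofA_310 h1
    (statementAScalar_of_310 h1 CasalsTeixeiraDaCosta2022_angularSign_holds h4 h4s) h4 h4s hη hB

/-- Twin of `b0TheoremClosed_of'` binding the corrected fact. -/
theorem b0TheoremClosed_of'_310 (h1 : CasalsTeixeiraDaCosta2022_theorem310)
    (h3 : CasalsTeixeiraDaCosta2022_partialModeStabilityProp38)
    (hR2 : R2_WindowConstantsB0) (hR3 : R3_B0Certificates) : B0TheoremClosed :=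
  ⟨msTruncClosed_of_facts'_310 h1 h3 hR2.1 (by norm_num) hR3.1,
    msTruncClosedScalar_of_facts'_310 h1 hR2.1 hR2.2 (by norm_num) hR3.2⟩

/-- **THE CLOSED-HALF-PLANE B0 THEOREM FROM THE CERTIFICATES, corrected (H1)** — twin of
`b0TheoremClosed_of_certificates`: from `CasalsTeixeiraDaCosta2022_theorem310`, (H3) and the signed
certificates R3 alone (R2 and (H2) discharged in the tree). -/
theorem b0TheoremClosed_of_certificates_310 (h1 : CasalsTeixeiraDaCosta2022_theorem310)
    (h3 : CasalsTeixeiraDaCosta2022_partialModeStabilityProp38) (hR3 : R3_B0Certificates) :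
    B0TheoremClosed :=
  b0TheoremClosed_of'_310 h1 h3 r2_windowConstantsB0 hR3

section Wave310

variable {ts : List CertTile}

/-- Twin of `msTruncClosed_atlas` binding the corrected fact (same argument order). -/
theorem msTruncClosed_atlas_310 (hWC : ∀ t ∈ ts, WindowConstants t.tile.box t.T)
    (hη : ∀ t ∈ ts, 0 ≤ t.eta) (h1 : CasalsTeixeiraDaCosta2022_theorem310)
    (h3 : CasalsTeixeiraDaCosta2022_partialModeStabilityProp38) (hdata : ∀ t ∈ ts, t.Data) :
    ∀ t ∈ ts, MSTruncClosed t.tile.box t.T t.lam :=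
  fun t ht => msTruncClosed_of_facts'_310 h1 h3 (hWC t ht) (hη t ht) (t.statementBbar (hdata t ht))

/-- Twin of `msTruncClosedScalar_atlas` binding the corrected fact (same argument order). -/
theorem msTruncClosedScalar_atlas_310 (hWC : ∀ t ∈ ts, WindowConstants t.tile.box t.T)
    (hWCs : ∀ t ∈ ts, WindowConstantsScalar t.tile.box t.T) (hη : ∀ t ∈ ts, 0 ≤ t.eta)
    (h1 : CasalsTeixeiraDaCosta2022_theorem310) (hdata : ∀ t ∈ ts, t.DataScalar) :
    ∀ t ∈ ts, MSTruncClosedScalar t.tile.box t.T t.lamScalar :=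
  fun t ht => msTruncClosedScalar_of_facts'_310 h1 (hWC t ht) (hWCs t ht) (hη t ht)
    (t.statementBbarScalar (hdata t ht))

/-- **The displayed wave theorem on the closed half-plane, corrected (H1)** — twin of
`noModeClosed_atlas` (same argument order): for every parameter point of the atlas there is a tile
containing it on which there is NO mode with `Im ω ≥ 0` (real axis and `ω = 0` included), `|m| ≤ 2`,
whose separation constant lies in the tile's λ-family when `ω` is in the tile's closed window — given
`CasalsTeixeiraDaCosta2022_theorem310`, (H3), the kernel-checked window constants and the DATA. -/
theorem noModeClosed_atlas_310 (hWC : ∀ t ∈ ts, WindowConstants t.tile.box t.T)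
    (hη : ∀ t ∈ ts, 0 ≤ t.eta) (h1 : CasalsTeixeiraDaCosta2022_theorem310)
    (h3 : CasalsTeixeiraDaCosta2022_partialModeStabilityProp38) (hdata : ∀ t ∈ ts, t.Data) :
    ∀ p ∈ atlas ts, ∃ t ∈ ts, p ∈ t.tile.box ∧
      NoModeWith p.1 p.2.1 p.2.2 (-2) {q | 0 ≤ q.1.im ∧ |q.2| ≤ 2}
        (fun ω m => {lam | ω ∈ windowClosed t.T m → lam ∈ t.lam p.2.1 p.2.2 ω m}) := by
  rintro p ⟨t, ht, hp⟩
  exact ⟨t, ht, hp, msTruncClosed_atlas_310 hWC hη h1 h3 hdata t ht p hp⟩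

end Wave310

end Summit.Ventures.KdS

end
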